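import Summits.QuantumFields.YangMills.Theorems.UnitScaleTiltProp7Row79AtMemberPInvT3
import Summits.QuantumFields.YangMills.Theorems.UnitScaleTiltProp7PairingSymmetryAtMemberT3
import Summits.QuantumFields.YangMills.Theorems.UnitScaleTiltProp7SectET3WilsonHessianT3SigmaRows
import HarnessLib

/-!
# Route `UnitScaleTilt`, crux «MinimiserStabilityRegPr» (stmt-QuantumFields-19200, stub EX `stub_existenceMinimalOrbit`, route (α)) — «ROWS-84-ETA»: **THE FOUR ROWS `h74 h79 hΔ hΔ₁` OF THE
# LATTICE (84) AT THE SLOT `Δ^η` (print's (127)–(128): «the functional (74), WITH THE OPERATOR Δ INSTEAD OF Δ_π», p. 297), FOR ALL HERMITIAN DIRECTIONS — NO LANDAU CONDITION**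

Cell `ym3-torus` (HUMAN RULING D-0037, YM ladder rung R3 — YM₃ on T³, NOT d = 4, NOT Clay; YM gap NOT proved), width seat `ym3-torus-px21` gen 2 (explicit-unit helper; lineage `hCrit93′`;
LOCATE «HMULT-127» `ym3-torus-px21/LOCATE-HMULT-127-px21g2.md` §3–§4).  THEOREMS ONLY (0 `def`, 0 `sorry`); `--supports stmt-QuantumFields-19200 --as helper`, count-neutral; NO claim on crux ∕ stub.

THE PRINT.  [Balaban1985Variational] p. 297: «Now we apply the linearizing transformation to configurations in the space (43), (123), and we get the functional (74), with the operator Δ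
instead of Δ_π … therefore we obtain the following equation on A₁′: ⟨δA′, J⟩ + ⟨δA′, ΔA₁′⟩ + … = 0 (127) for all δA′ satisfying QδA′ = 0 … (128) where Δ_a = Δ + DRD* + Q*aQ».  The (81)-expansion
of lit `B11Eq81ExpansionZpow` takes `Δπ` as a PARAMETER; at `Δπ := Δ̂^η` (the current of brick L0b's `DeltaEtaSlot`) its row (r74) «⟨Y, Δ_πY⟩ = ⟨Y, ΔY⟩» is an IDENTITY for every Hermitian
`Y` (no Landau condition), so (81)∕(84) hold along EVERY Hermitian ray — which is what (127) uses.  This file supplies lit ✓`hasDerivAt_actionZ_chartRay_real`'s rows `h74 h79 hΔ hΔ₁` at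
`Δπ := currentCLM … (DeltaEtaSlot … U₀)`, `Δ₁ := currentCLM … (DeltaEtaSlot … U₀ + TJSlotP … U₀)` (print's `Δ − Δ⁽²⁾`, the J-term of (79) with `H := H46P`), `P Y := ∀ b, star (ιY b) = ιY b`.

WHAT IS PROVED (member `F`, `K n`, `h : n ≤ K`, `0 ≤ a`; `U₀ ∈ 𝔘_k(ε₀)` with `10⁹L²e ≤ 1`, `10¹²L³ε₀ ≤ 1` where the J-term's reality is needed; ns `…Theorems.Prop7Rows84AtEtaSlot`):
* §1 ★★`pair27_eq_hessPair_of_forall (T) (hT : ∀ v, ⟪v, T v⟫ = ⟪v, Δ^η v⟫) (Y) (hR)` (Landau-free twin of ✓`Prop7Row74AtMember.pair27_eq_hessPair_of_landau`) and ★★`h74_member_DeltaEtaSlot :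
  ∀ Y, (∀ b, star (ιY b) = ιY b) → pair27 tr (Δ̂^η Y) (flat115 Y) = hessPair …` — (r74) at `Δ^η`, every Hermitian `Y`.
* §2 `inner_DeltaEta_add_TJP_sub` (`⟪v, (Δ^η + T_Jᴾ)v⟫ − ⟪v, Δ^ηv⟫ = tjSesqP v v`, every `v`), ★★★`pair27_DeltaEtaTJ_eq_of_star_eq` and ★★`h79_member_DeltaEtaTJ` — (r79) at (`Δ^η + T_Jᴾ`, `Δ^η`), every
  Hermitian `Y` (the calculus of ✓`Prop7Row79AtMember` §1 and the reality ✓`tjFormP_star` as in ✓`Prop7Row79AtMemberPInv`).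
* §3 ★★`hDelta_member_DeltaEtaSlot` (every `U₀`: ✓`DeltaEta_isSymmetric` + ✓`DeltaEta_toL2_star`) and ★★`hDelta1_member_DeltaEtaTJ` (`U₀ ∈ 𝔘_k(ε₀)`: + ✓`TJP_rows_at_regPr`) via
  ✓`Prop7PairingSymmetryAtMember.pair27_currentCLM_symm_of_rows` — lit's `hΔ`, `hΔ₁` at these letters.
HONEST SCOPE.  Re-lettering of landed rows at the slot `Δ^η`; regime rows displayed; no estimate; not a proof of any stub; nothing continuum ∕ OS ∕ mass-gap ∕ Clay.

References: T. Bałaban, CMP **102** (1985) 277–309 [Balaban1985Variational] ((74) p.289, (78)–(81), (84) p.290, (127)–(130) p.297); CMP **99** (1985) 389–434 [Balaban1985BackgroundPropagators]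
((3.10)–(3.12) p.392, (3.127) p.421).
-/

set_option autoImplicit false

noncomputable section

open scoped InnerProductSpace ComplexConjugate Matrix.Norms.L2Operator BigOperators Topology
open Complex (I)
open Filter Metric

namespace Summit.QuantumFields.YangMills.Theorems.Prop7Rows84AtEtaSlot

open Literature.MathematicalPhysics.QuantumFieldTheory.Balaban1983to89
open Literature.MathematicalPhysics.QuantumFieldTheory.Balaban1983to89.T3ContinuumYM3Torus
open T3SectALandauChart (eta eta_pos bgUnits formComp)
open T3PrintedRegularMinimiser (RegPr)
open B9SectCLatticeCarrier (Bond)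
open B9TorusCalculus (torusT)
open B9Eq39Adjoint (hessPair)
open B11Eq115Space (NegSize Space115 JetSup NegSup)
open B11Eq111FrakG (nabla115)
open B11Eq103H1Complex (SiteL2K BondL2K funEquiv)
open B11Eq98CurrentSlot (Jcur)
open B11Eq90Transpose (pair27)
open B11Eq90V0primeCurrent (Tsh Ucur curL flat115 flat115_apply)
open B11Eq80Current (quadPart)
open B9Eq3119DeltaPiCarrier (currentCLM)
open Summit.QuantumFields.YangMills.Theorems.Prop7SectET3Transport (periodsT3 bondEquiv bgOfCfg)
open Summit.QuantumFields.YangMills.Theorems.Prop7SectET3HilbertLetters (W₂ frobEquiv toL2 DL2 DstarL2)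
open Summit.QuantumFields.YangMills.Theorems.Prop7SectET3CurvedPropagators (H1f)
open Summit.QuantumFields.YangMills.Theorems.Prop7SectET3DeltaPiPInv (DeltaPiSlotP H46P)
open Summit.QuantumFields.YangMills.Theorems.Prop7SectET3DeltaOne (actionGrad avgHess avgHess_def)
open Summit.QuantumFields.YangMills.Theorems.Prop7SectET3DeltaOnePInv (tjFormP tjSesqP TJP TJSlotP tjFormP_apply tjSesqP_apply inner_TJP_left TJSlotP_apply)
open Summit.QuantumFields.YangMills.Theorems.Prop7SectET3RealityPInvJTerm (tjFormP_star tjSesqP_conj_symm TJP_rows_at_regPr)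
open Summit.QuantumFields.YangMills.Theorems.Prop7SymAvgTwSym (logChartTwS QTwS CmapTwS)
open Summit.QuantumFields.YangMills.Theorems.Prop7SectET3WilsonHessian (DeltaEta DeltaEtaSlot DeltaEtaSlot_apply DeltaEta_isSymmetric DeltaEta_toL2_star)
open Summit.QuantumFields.YangMills.Theorems.Prop7Crit93OfEq111 (pair27_eq_inner_toL2 toL2_currentCLM funEquiv_symm_eq_toL2')
open Summit.QuantumFields.YangMills.Theorems.Prop7ActionGradCurrent (actionGrad_eq_inner_toL2_Jcur)
open Summit.QuantumFields.YangMills.Theorems.Prop7Row74AtMember (hessPair_Tsh_bgOfCfg_eq hessPair_eta_scale inner_toL2_DeltaEta_toL2_eq_hessPair)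
open Summit.QuantumFields.YangMills.Theorems.Prop7Row79AtMember (quadPart_Ctilde_eq tjForm_rows_of_regPr)
open Summit.QuantumFields.YangMills.Theorems.Prop7Row79AtMemberPInv (smul_iota_H1f_eq_H46P_smul pair27_Jcur_iota_H1fP_eq)
open Summit.QuantumFields.YangMills.Theorems.Prop7PairingSymmetryAtMember (pair27_currentCLM_symm_of_rows)

variable {F : T3Family} {n K : ℕ} {h : n ≤ K} {c₀ cB a : ℝ} [Fact (0 < c₀)] [Fact (0 < cB)]
variable [Fact (0 < (F.L : ℝ))] [Fact (0 < ((F.L : ℝ)⁻¹) ^ (K - n))]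

/-! ## §1 (r74) at the slot `Δ^η`: an identity for every Hermitian field -/

omit [Fact (0 < cB)] in
/-- ★★ **(r74) GENERIC, LANDAU-FREE**: for an `L²` operator `T` whose quadratic form agrees with `Δ^η(U₀)`'s on ALL of `L²` (`hT`) and a (115)-field `Y` with Hermitian exponent reading,
`pair27 tr (T̂ Y) (flat115 Y) = hessPair Tsh (Ucur (bgOfCfg F K U₀)) η 3 tr (curL (flat115 Y))` (✓`Prop7Row74AtMember.pair27_eq_hessPair_of_landau` without the Landau premise).
[cite: Balaban1985Variational, (74) p.289, (127) p.297; Balaban1985BackgroundPropagators, (3.10)–(3.12) p.392] -/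
theorem pair27_eq_hessPair_of_forall (U₀ : GaugeField (F.P K) 0 (Matrix.specialUnitaryGroup (Fin 2) ℂ))
    (T : BondL2K ℂ 3 (periodsT3 F K) c₀ W₂ →ₗ[ℂ] BondL2K ℂ 3 (periodsT3 F K) c₀ W₂)
    (hT : ∀ v : BondL2K ℂ 3 (periodsT3 F K) c₀ W₂, ⟪v, T v⟫_ℂ = ⟪v, DeltaEta F n K c₀ U₀ v⟫_ℂ)
    (Y : Space115 (F.L : ℝ) (((F.L : ℝ)⁻¹) ^ (K - n)) (fun _ : Bond 3 (periodsT3 F K) => K - n) (fun _ : Bond 3 (periodsT3 F K) × Fin 3 => K - n)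
      (nabla115 (((F.L : ℝ)⁻¹) ^ (K - n)) (bgOfCfg F K U₀)))
    (hR : ∀ b : PBond (F.P K) 0, star (JetSup.equiv _ _ _ Y (bondEquiv F K b)) = JetSup.equiv _ _ _ Y (bondEquiv F K b)) :
    pair27 (LinearMap.toContinuousLinearMap (Matrix.traceLinearMap (Fin 2) ℂ ℂ))
        (currentCLM frobEquiv (fun _ : Bond 3 (periodsT3 F K) × Fin 3 => K - n) (nabla115 (((F.L : ℝ)⁻¹) ^ (K - n)) (bgOfCfg F K U₀)) T Y) (flat115 Y)
      = hessPair Tsh (Ucur (bgOfCfg F K U₀)) (((F.L : ℝ)⁻¹) ^ (K - n)) 3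
          ((LinearMap.toContinuousLinearMap (Matrix.traceLinearMap (Fin 2) ℂ ℂ) : Matrix (Fin 2) (Fin 2) ℂ →L[ℂ] ℂ) : Matrix (Fin 2) (Fin 2) ℂ →ₗ[ℂ] ℂ) (curL (flat115 Y)) := by
  have hτ : ∀ a b : Matrix (Fin 2) (Fin 2) ℂ,
      ((LinearMap.toContinuousLinearMap (Matrix.traceLinearMap (Fin 2) ℂ ℂ) : Matrix (Fin 2) (Fin 2) ℂ →L[ℂ] ℂ) : Matrix (Fin 2) (Fin 2) ℂ →ₗ[ℂ] ℂ) (a * b)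
        = ((LinearMap.toContinuousLinearMap (Matrix.traceLinearMap (Fin 2) ℂ ℂ) : Matrix (Fin 2) (Fin 2) ℂ →L[ℂ] ℂ) : Matrix (Fin 2) (Fin 2) ℂ →ₗ[ℂ] ℂ) (b * a) := fun a b => by
    simp only [LinearMap.coe_toContinuousLinearMap, Matrix.traceLinearMap_apply, Matrix.trace_mul_comm a b]
  have hstar : star (fun b : PBond (F.P K) 0 => JetSup.equiv _ _ _ Y (bondEquiv F K b)) = fun b : PBond (F.P K) 0 => JetSup.equiv _ _ _ Y (bondEquiv F K b) := funext hR
  have hflat : (fun b : PBond (F.P K) 0 => flat115 Y (bondEquiv F K b)) = fun b : PBond (F.P K) 0 => JetSup.equiv _ _ _ Y (bondEquiv F K b) := rfl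
  have hη : (((eta F n K : ℝ) : ℂ)) = ((((F.L : ℝ)⁻¹) ^ (K - n) : ℝ) : ℂ) := rfl
  have hη0 : ((((F.L : ℝ)⁻¹) ^ (K - n) : ℝ) : ℂ) ≠ 0 := Complex.ofReal_ne_zero.2 (Fact.out : 0 < ((F.L : ℝ)⁻¹) ^ (K - n)).ne'
  have hc : (c₀ : ℂ) ≠ 0 := Complex.ofReal_ne_zero.2 (Fact.out : 0 < c₀).ne'
  rw [pair27_eq_inner_toL2 (c₀ := c₀), toL2_currentCLM, hflat, hstar, hT, inner_toL2_DeltaEta_toL2_eq_hessPair U₀ hstar, hη,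
    hessPair_Tsh_bgOfCfg_eq _ hτ, hessPair_eta_scale _ _ _ hτ (((F.L : ℝ)⁻¹) ^ (K - n)) 3]
  field_simp
  rfl

omit [Fact (0 < cB)] in
/-- ★★ **lit's ROW `h74` AT THE SLOT `Δ^η`** (`Δπ := currentCLM … (DeltaEtaSlot … U₀)`), `P Y := ∀ b, star (ιY b) = ιY b` — an identity for every Hermitian `Y`, every `U₀` (print's (127):
«with the operator Δ instead of Δ_π»). [cite: Balaban1985Variational, (74) p.289, (127) p.297] -/
theorem h74_member_DeltaEtaSlot (U₀ : GaugeField (F.P K) 0 (Matrix.specialUnitaryGroup (Fin 2) ℂ)) :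
    ∀ Y : Space115 (F.L : ℝ) (((F.L : ℝ)⁻¹) ^ (K - n)) (fun _ : Bond 3 (periodsT3 F K) => K - n) (fun _ : Bond 3 (periodsT3 F K) × Fin 3 => K - n)
        (nabla115 (((F.L : ℝ)⁻¹) ^ (K - n)) (bgOfCfg F K U₀)),
      (∀ b : PBond (F.P K) 0, star (JetSup.equiv _ _ _ Y (bondEquiv F K b)) = JetSup.equiv _ _ _ Y (bondEquiv F K b)) →
        pair27 (LinearMap.toContinuousLinearMap (Matrix.traceLinearMap (Fin 2) ℂ ℂ))
            (currentCLM frobEquiv (fun _ : Bond 3 (periodsT3 F K) × Fin 3 => K - n) (nabla115 (((F.L : ℝ)⁻¹) ^ (K - n)) (bgOfCfg F K U₀)) (DeltaEtaSlot F n K c₀ U₀) Y)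
            (flat115 Y)
          = hessPair Tsh (Ucur (bgOfCfg F K U₀)) (((F.L : ℝ)⁻¹) ^ (K - n)) 3
              ((LinearMap.toContinuousLinearMap (Matrix.traceLinearMap (Fin 2) ℂ ℂ) : Matrix (Fin 2) (Fin 2) ℂ →L[ℂ] ℂ) : Matrix (Fin 2) (Fin 2) ℂ →ₗ[ℂ] ℂ) (curL (flat115 Y)) :=
  fun Y hR => pair27_eq_hessPair_of_forall U₀ (DeltaEtaSlot F n K c₀ U₀) (fun v => by rw [DeltaEtaSlot_apply]) Y hR

/-! ## §2 (r79) at (`Δ^η + T_Jᴾ`, `Δ^η`): every Hermitian field -/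

/-- **`⟪v, (Δ^η + T_Jᴾ)v⟫ − ⟪v, Δ^ηv⟫ = tjSesqP v v` FOR EVERY `v`** (no sandwich, no Landau condition; `T_Jᴾ` conjugate-symmetric at `U₀ ∈ 𝔘_k(ε₀)`).
[cite: Balaban1985BackgroundPropagators, (3.127) p.421; Balaban1985Variational, (79) p.290, (127) p.297] -/
theorem inner_DeltaEta_add_TJP_sub (ha : 0 ≤ a) {ε₀ e : ℝ} (hε₀ : 0 < ε₀) (he : 0 < e) (hWe : 10 ^ 9 * (F.L : ℝ) ^ 2 * e ≤ 1) (hWε : 10 ^ 12 * (F.L : ℝ) ^ 3 * ε₀ ≤ 1)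
    (U₀ : GaugeField (F.P K) 0 (Matrix.specialUnitaryGroup (Fin 2) ℂ)) (hreg : RegPr F n K ε₀ U₀) (v : BondL2K ℂ 3 (periodsT3 F K) c₀ W₂) :
    ⟪v, (DeltaEtaSlot F n K c₀ U₀ + TJSlotP F n K h c₀ cB a U₀) v⟫_ℂ - ⟪v, DeltaEtaSlot F n K c₀ U₀ v⟫_ℂ = tjSesqP F n K h c₀ cB a U₀ v v := by
  obtain ⟨hQ, hAs, hAr, hAc⟩ := tjForm_rows_of_regPr (h := h) hε₀ he hWe hWε U₀ hreg
  rw [LinearMap.add_apply, inner_add_right, add_sub_cancel_left, TJSlotP_apply, ← inner_conj_symm, inner_TJP_left, tjSesqP_conj_symm U₀ ha hQ hAs hAr hAc]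

/-- ★★★ **(r79) AT THE SLOT (`Δ^η + T_Jᴾ`, `Δ^η`)** for `U₀ ∈ 𝔘_k(ε₀)` in the windows and every (115)-field `Y` with Hermitian exponent reading (no Landau condition):
`pair27 tr ((Δ^η + T_Jᴾ)^ Y) (flat115 Y) = pair27 tr (Δ̂^η Y) (flat115 Y) − 2·pair27 tr J (flat115 (H̃ᴾ (C̃⁽²⁾ Y)))`, `H̃ᴾ := H1f …Δ_πᴾ… U₀` (the chart's `H`), `C̃ := (−I)•CmapTwS U₀ (κ_f • ι·)`.
[cite: Balaban1985Variational, (78)–(79) p.290, (127)–(128) p.297; Balaban1985BackgroundPropagators, (3.127) p.421] -/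
theorem pair27_DeltaEtaTJ_eq_of_star_eq (ha : 0 ≤ a) {ε₀ e : ℝ} (hε₀ : 0 < ε₀) (he : 0 < e) (hWe : 10 ^ 9 * (F.L : ℝ) ^ 2 * e ≤ 1) (hWε : 10 ^ 12 * (F.L : ℝ) ^ 3 * ε₀ ≤ 1)
    (U₀ : GaugeField (F.P K) 0 (Matrix.specialUnitaryGroup (Fin 2) ℂ)) (hreg : RegPr F n K ε₀ U₀)
    (Y : Space115 (F.L : ℝ) (((F.L : ℝ)⁻¹) ^ (K - n)) (fun _ : Bond 3 (periodsT3 F K) => K - n) (fun _ : Bond 3 (periodsT3 F K) × Fin 3 => K - n)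
      (nabla115 (((F.L : ℝ)⁻¹) ^ (K - n)) (bgOfCfg F K U₀)))
    (hR : ∀ b : PBond (F.P K) 0, star (JetSup.equiv _ _ _ Y (bondEquiv F K b)) = JetSup.equiv _ _ _ Y (bondEquiv F K b)) :
    pair27 (LinearMap.toContinuousLinearMap (Matrix.traceLinearMap (Fin 2) ℂ ℂ))
        (currentCLM frobEquiv (fun _ : Bond 3 (periodsT3 F K) × Fin 3 => K - n) (nabla115 (((F.L : ℝ)⁻¹) ^ (K - n)) (bgOfCfg F K U₀)) (DeltaEtaSlot F n K c₀ U₀ + TJSlotP F n K h c₀ cB a U₀) Y)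
        (flat115 Y)
      = pair27 (LinearMap.toContinuousLinearMap (Matrix.traceLinearMap (Fin 2) ℂ ℂ))
          (currentCLM frobEquiv (fun _ : Bond 3 (periodsT3 F K) × Fin 3 => K - n) (nabla115 (((F.L : ℝ)⁻¹) ^ (K - n)) (bgOfCfg F K U₀)) (DeltaEtaSlot F n K c₀ U₀) Y)
          (flat115 Y)
        - 2 * pair27 (LinearMap.toContinuousLinearMap (Matrix.traceLinearMap (Fin 2) ℂ ℂ))
          (Jcur (bgOfCfg F K U₀) : NegSize (F.L : ℝ) (((F.L : ℝ)⁻¹) ^ (K - n)) (fun _ : Bond 3 (periodsT3 F K) => K - n) 3 (Matrix (Fin 2) (Fin 2) ℂ))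
          (flat115 (H1f F n K h c₀ cB a (DeltaPiSlotP F n K h c₀ cB a) U₀
            (quadPart (fun A' : Space115 (F.L : ℝ) (((F.L : ℝ)⁻¹) ^ (K - n)) (fun _ : Bond 3 (periodsT3 F K) => K - n)
                (fun _ : Bond 3 (periodsT3 F K) × Fin 3 => K - n) (nabla115 (((F.L : ℝ)⁻¹) ^ (K - n)) (bgOfCfg F K U₀)) =>
                  (-Complex.I) • CmapTwS F n K h U₀ (((((eta F n K : ℝ) : ℂ)) * Complex.I) • fun b : PBond (F.P K) 0 => JetSup.equiv _ _ _ A' (bondEquiv F K b))) Y))) := by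
  have hη : ((((F.L : ℝ)⁻¹) ^ (K - n) : ℝ) : ℂ) = (((eta F n K : ℝ) : ℂ)) := rfl
  have hη0 : (((eta F n K : ℝ) : ℂ)) ≠ 0 := Complex.ofReal_ne_zero.2 (eta_pos F n K).ne'
  have hc : (c₀ : ℂ) ≠ 0 := Complex.ofReal_ne_zero.2 (Fact.out : 0 < c₀).ne'
  have hI : Complex.I * Complex.I = -1 := Complex.I_mul_I
  have hstar : star (fun b : PBond (F.P K) 0 => JetSup.equiv _ _ _ Y (bondEquiv F K b)) = fun b : PBond (F.P K) 0 => JetSup.equiv _ _ _ Y (bondEquiv F K b) := funext hR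
  -- the quadratic letter `C̃⁽²⁾(Y) = (Iη²∕2)•avgHess ιY ιY` and the `J`-pairing of its `H̃`-image: `= η·t_J[ιY, ιY]`
  have hT' : actionGrad F K U₀ (H46P F n K h c₀ cB a U₀ (avgHess F n K h U₀ (fun b : PBond (F.P K) 0 => JetSup.equiv _ _ _ Y (bondEquiv F K b))
      (fun b : PBond (F.P K) 0 => JetSup.equiv _ _ _ Y (bondEquiv F K b))))
      = -tjFormP F n K h c₀ cB a U₀ (fun b : PBond (F.P K) 0 => JetSup.equiv _ _ _ Y (bondEquiv F K b)) (fun b : PBond (F.P K) 0 => JetSup.equiv _ _ _ Y (bondEquiv F K b)) := by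
    rw [tjFormP_apply, neg_neg]
  rw [quadPart_Ctilde_eq (h := h) hε₀ he hWe hWε U₀ hreg Y]
  have hJ := pair27_Jcur_iota_H1fP_eq (h := h) (c₀ := c₀) (cB := cB) (a := a) U₀ (((Complex.I * (((eta F n K : ℝ) : ℂ)) ^ 2) / 2) •
    avgHess F n K h U₀ (fun b : PBond (F.P K) 0 => JetSup.equiv _ _ _ Y (bondEquiv F K b)) (fun b : PBond (F.P K) 0 => JetSup.equiv _ _ _ Y (bondEquiv F K b)))
  have hJ2 : 2 * Complex.I * actionGrad F K U₀ (H46P F n K h c₀ cB a U₀ (Complex.I • (((Complex.I * (((eta F n K : ℝ) : ℂ)) ^ 2) / 2) •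
      avgHess F n K h U₀ (fun b : PBond (F.P K) 0 => JetSup.equiv _ _ _ Y (bondEquiv F K b)) (fun b : PBond (F.P K) 0 => JetSup.equiv _ _ _ Y (bondEquiv F K b)))))
      = 2 * Complex.I * ((Complex.I * ((Complex.I * (((eta F n K : ℝ) : ℂ)) ^ 2) / 2)) *
          -tjFormP F n K h c₀ cB a U₀ (fun b : PBond (F.P K) 0 => JetSup.equiv _ _ _ Y (bondEquiv F K b)) (fun b : PBond (F.P K) 0 => JetSup.equiv _ _ _ Y (bondEquiv F K b))) := by
    rw [smul_smul, map_smul, map_smul, smul_eq_mul, hT']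
  have hP2 : pair27 (LinearMap.toContinuousLinearMap (Matrix.traceLinearMap (Fin 2) ℂ ℂ))
      (Jcur (bgOfCfg F K U₀) : NegSize (F.L : ℝ) (((F.L : ℝ)⁻¹) ^ (K - n)) (fun _ : Bond 3 (periodsT3 F K) => K - n) 3 (Matrix (Fin 2) (Fin 2) ℂ))
      (flat115 (H1f F n K h c₀ cB a (DeltaPiSlotP F n K h c₀ cB a) U₀ ((((Complex.I * (((eta F n K : ℝ) : ℂ)) ^ 2) / 2) •
        avgHess F n K h U₀ (fun b : PBond (F.P K) 0 => JetSup.equiv _ _ _ Y (bondEquiv F K b)) (fun b : PBond (F.P K) 0 => JetSup.equiv _ _ _ Y (bondEquiv F K b))))))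
      = (((eta F n K : ℝ) : ℂ)) * tjFormP F n K h c₀ cB a U₀ (fun b : PBond (F.P K) 0 => JetSup.equiv _ _ _ Y (bondEquiv F K b)) (fun b : PBond (F.P K) 0 => JetSup.equiv _ _ _ Y (bondEquiv F K b)) := by
    have hκ : (((eta F n K : ℝ) : ℂ)) * Complex.I ≠ 0 := mul_ne_zero hη0 Complex.I_ne_zero
    refine mul_left_cancel₀ hκ ?_
    rw [hJ, hJ2]
    linear_combination (-((((eta F n K : ℝ) : ℂ)) ^ 2) * Complex.I *
      tjFormP F n K h c₀ cB a U₀ (fun b : PBond (F.P K) 0 => JetSup.equiv _ _ _ Y (bondEquiv F K b)) (fun b : PBond (F.P K) 0 => JetSup.equiv _ _ _ Y (bondEquiv F K b))) * hI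
  rw [hP2]
  -- the two Hessian pairings in `L²` letters; `⟪v, Δ₁v⟫ − ⟪v, Δ_πv⟫ = tjSesq v v = (−2c₀∕η²)·t_J[ιY, ιY]`
  have hS : tjSesqP F n K h c₀ cB a U₀ (toL2 F K c₀ (fun b : PBond (F.P K) 0 => JetSup.equiv _ _ _ Y (bondEquiv F K b)))
      (toL2 F K c₀ (fun b : PBond (F.P K) 0 => JetSup.equiv _ _ _ Y (bondEquiv F K b)))
      = ((-(2 * (c₀ : ℂ)) / (((eta F n K : ℝ) : ℂ)) ^ 2)) *
          tjFormP F n K h c₀ cB a U₀ (fun b : PBond (F.P K) 0 => JetSup.equiv _ _ _ Y (bondEquiv F K b)) (fun b : PBond (F.P K) 0 => JetSup.equiv _ _ _ Y (bondEquiv F K b)) := by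
    rw [tjSesqP_apply, LinearEquiv.symm_apply_apply, hstar]
  have h1 := inner_DeltaEta_add_TJP_sub (h := h) (c₀ := c₀) (cB := cB) (a := a) ha hε₀ he hWe hWε U₀ hreg (toL2 F K c₀ (fun b : PBond (F.P K) 0 => JetSup.equiv _ _ _ Y (bondEquiv F K b)))
  rw [hS] at h1
  simp only [pair27_eq_inner_toL2 (c₀ := c₀), toL2_currentCLM, flat115_apply, hstar, hη]
  rw [eq_add_of_sub_eq h1]  -- `⟪v, Δ₁v⟫ = (−2c₀∕η²)·t_J + ⟪v, Δ_πv⟫`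
  field_simp
  ring


/-- ★★ **lit's ROW `h79` AT (`Δ^η + T_Jᴾ`, `Δ^η`)**, `P Y := ∀ b, star (ιY b) = ιY b`, for `U₀ ∈ 𝔘_k(ε₀)` in the windows, `0 ≤ a`. [cite: Balaban1985Variational, (79) p.290, (127) p.297] -/
theorem h79_member_DeltaEtaTJ (ha : 0 ≤ a) {ε₀ e : ℝ} (hε₀ : 0 < ε₀) (he : 0 < e) (hWe : 10 ^ 9 * (F.L : ℝ) ^ 2 * e ≤ 1) (hWε : 10 ^ 12 * (F.L : ℝ) ^ 3 * ε₀ ≤ 1)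
    (U₀ : GaugeField (F.P K) 0 (Matrix.specialUnitaryGroup (Fin 2) ℂ)) (hreg : RegPr F n K ε₀ U₀) :
    ∀ Y : Space115 (F.L : ℝ) (((F.L : ℝ)⁻¹) ^ (K - n)) (fun _ : Bond 3 (periodsT3 F K) => K - n) (fun _ : Bond 3 (periodsT3 F K) × Fin 3 => K - n)
        (nabla115 (((F.L : ℝ)⁻¹) ^ (K - n)) (bgOfCfg F K U₀)),
      (∀ b : PBond (F.P K) 0, star (JetSup.equiv _ _ _ Y (bondEquiv F K b)) = JetSup.equiv _ _ _ Y (bondEquiv F K b)) →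
        pair27 (LinearMap.toContinuousLinearMap (Matrix.traceLinearMap (Fin 2) ℂ ℂ))
            (currentCLM frobEquiv (fun _ : Bond 3 (periodsT3 F K) × Fin 3 => K - n) (nabla115 (((F.L : ℝ)⁻¹) ^ (K - n)) (bgOfCfg F K U₀))
              (DeltaEtaSlot F n K c₀ U₀ + TJSlotP F n K h c₀ cB a U₀) Y) (flat115 Y)
          = pair27 (LinearMap.toContinuousLinearMap (Matrix.traceLinearMap (Fin 2) ℂ ℂ))
              (currentCLM frobEquiv (fun _ : Bond 3 (periodsT3 F K) × Fin 3 => K - n) (nabla115 (((F.L : ℝ)⁻¹) ^ (K - n)) (bgOfCfg F K U₀)) (DeltaEtaSlot F n K c₀ U₀) Y) (flat115 Y)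
            - 2 * pair27 (LinearMap.toContinuousLinearMap (Matrix.traceLinearMap (Fin 2) ℂ ℂ))
              (Jcur (bgOfCfg F K U₀) : NegSize (F.L : ℝ) (((F.L : ℝ)⁻¹) ^ (K - n)) (fun _ : Bond 3 (periodsT3 F K) => K - n) 3 (Matrix (Fin 2) (Fin 2) ℂ))
              (flat115 (H1f F n K h c₀ cB a (DeltaPiSlotP F n K h c₀ cB a) U₀
                (quadPart (fun A' : Space115 (F.L : ℝ) (((F.L : ℝ)⁻¹) ^ (K - n)) (fun _ : Bond 3 (periodsT3 F K) => K - n)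
                    (fun _ : Bond 3 (periodsT3 F K) × Fin 3 => K - n) (nabla115 (((F.L : ℝ)⁻¹) ^ (K - n)) (bgOfCfg F K U₀)) =>
                      (-Complex.I) • CmapTwS F n K h U₀ (((((eta F n K : ℝ) : ℂ)) * Complex.I) • fun b : PBond (F.P K) 0 => JetSup.equiv _ _ _ A' (bondEquiv F K b))) Y))) :=
  fun Y hR => pair27_DeltaEtaTJ_eq_of_star_eq ha hε₀ he hWe hWε U₀ hreg Y hR

/-! ## §3 `hΔ`, `hΔ₁` at the slot `Δ^η` -/

omit [Fact (0 < cB)] in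
/-- ★★ **lit's ROW `hΔ` AT THE SLOT `Δ^η`, EVERY `U₀`**: `Δ^η(U₀)` is symmetric as a (27)-bilinear form (Hermitian symmetry ✓`DeltaEta_isSymmetric` + σ-row ✓`DeltaEta_toL2_star`).
[cite: Balaban1985BackgroundPropagators, (3.10)–(3.12) p.392; Balaban1985Variational, (127) p.297] -/
theorem hDelta_member_DeltaEtaSlot (U₀ : GaugeField (F.P K) 0 (Matrix.specialUnitaryGroup (Fin 2) ℂ)) :
    ∀ Y Z : Space115 (F.L : ℝ) (((F.L : ℝ)⁻¹) ^ (K - n)) (fun _ : Bond 3 (periodsT3 F K) => K - n) (fun _ : Bond 3 (periodsT3 F K) × Fin 3 => K - n)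
        (nabla115 (((F.L : ℝ)⁻¹) ^ (K - n)) (bgOfCfg F K U₀)),
      pair27 (LinearMap.toContinuousLinearMap (Matrix.traceLinearMap (Fin 2) ℂ ℂ))
          (currentCLM frobEquiv (fun _ : Bond 3 (periodsT3 F K) × Fin 3 => K - n) (nabla115 (((F.L : ℝ)⁻¹) ^ (K - n)) (bgOfCfg F K U₀)) (DeltaEtaSlot F n K c₀ U₀) Y) (flat115 Z)
        = pair27 (LinearMap.toContinuousLinearMap (Matrix.traceLinearMap (Fin 2) ℂ ℂ))
            (currentCLM frobEquiv (fun _ : Bond 3 (periodsT3 F K) × Fin 3 => K - n) (nabla115 (((F.L : ℝ)⁻¹) ^ (K - n)) (bgOfCfg F K U₀)) (DeltaEtaSlot F n K c₀ U₀) Z) (flat115 Y) :=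
  fun Y Z => pair27_currentCLM_symm_of_rows U₀ (DeltaEtaSlot F n K c₀ U₀) (fun x y => by rw [DeltaEtaSlot_apply, DeltaEtaSlot_apply]; exact DeltaEta_isSymmetric U₀ x y)
    (fun f => by
      have key := DeltaEta_toL2_star (F := F) (n := n) (K := K) (c₀ := c₀) U₀ ((toL2 F K c₀).symm f)
      rw [LinearEquiv.apply_symm_apply] at key
      rw [DeltaEtaSlot_apply, DeltaEtaSlot_apply]
      exact key) Y Z

/-- ★★ **lit's ROW `hΔ₁` AT (`Δ^η + T_Jᴾ`)**, for `U₀ ∈ 𝔘_k(ε₀)` in the windows, `0 ≤ a` (+ ✓`TJP_rows_at_regPr`: σ-row and symmetry of `T_Jᴾ`).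
[cite: Balaban1985BackgroundPropagators, (3.127) p.421; Balaban1985Variational, (127)–(128) p.297] -/
theorem hDelta1_member_DeltaEtaTJ (ha : 0 ≤ a) {ε₀ e : ℝ} (hε₀ : 0 < ε₀) (he : 0 < e) (hWe : 10 ^ 9 * (F.L : ℝ) ^ 2 * e ≤ 1) (hWε : 10 ^ 12 * (F.L : ℝ) ^ 3 * ε₀ ≤ 1)
    (U₀ : GaugeField (F.P K) 0 (Matrix.specialUnitaryGroup (Fin 2) ℂ)) (hreg : RegPr F n K ε₀ U₀) :
    ∀ Y Z : Space115 (F.L : ℝ) (((F.L : ℝ)⁻¹) ^ (K - n)) (fun _ : Bond 3 (periodsT3 F K) => K - n) (fun _ : Bond 3 (periodsT3 F K) × Fin 3 => K - n)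
        (nabla115 (((F.L : ℝ)⁻¹) ^ (K - n)) (bgOfCfg F K U₀)),
      pair27 (LinearMap.toContinuousLinearMap (Matrix.traceLinearMap (Fin 2) ℂ ℂ))
          (currentCLM frobEquiv (fun _ : Bond 3 (periodsT3 F K) × Fin 3 => K - n) (nabla115 (((F.L : ℝ)⁻¹) ^ (K - n)) (bgOfCfg F K U₀))
            (DeltaEtaSlot F n K c₀ U₀ + TJSlotP F n K h c₀ cB a U₀) Y) (flat115 Z)
        = pair27 (LinearMap.toContinuousLinearMap (Matrix.traceLinearMap (Fin 2) ℂ ℂ))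
            (currentCLM frobEquiv (fun _ : Bond 3 (periodsT3 F K) × Fin 3 => K - n) (nabla115 (((F.L : ℝ)⁻¹) ^ (K - n)) (bgOfCfg F K U₀))
              (DeltaEtaSlot F n K c₀ U₀ + TJSlotP F n K h c₀ cB a U₀) Z) (flat115 Y) :=
  fun Y Z => by
    obtain ⟨hTσ, -, hTsymm⟩ := TJP_rows_at_regPr F n K h c₀ cB a U₀ ha hε₀ he hWe hWε hreg
    have hΔσ : ∀ f : BondL2K ℂ 3 (periodsT3 F K) c₀ W₂,
        DeltaEta F n K c₀ U₀ (toL2 F K c₀ (star ((toL2 F K c₀).symm f))) = toL2 F K c₀ (star ((toL2 F K c₀).symm (DeltaEta F n K c₀ U₀ f))) := fun f => by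
      have key := DeltaEta_toL2_star (F := F) (n := n) (K := K) (c₀ := c₀) U₀ ((toL2 F K c₀).symm f)
      rwa [LinearEquiv.apply_symm_apply] at key
    refine pair27_currentCLM_symm_of_rows U₀ (DeltaEtaSlot F n K c₀ U₀ + TJSlotP F n K h c₀ cB a U₀) ?_ ?_ Y Z
    · intro x y
      rw [LinearMap.add_apply, LinearMap.add_apply, inner_add_left, inner_add_right, DeltaEtaSlot_apply, DeltaEtaSlot_apply, TJSlotP_apply, TJSlotP_apply]
      have h1 := DeltaEta_isSymmetric (n := n) (c₀ := c₀) U₀ x y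
      have h2 := hTsymm x y
      simp only [ContinuousLinearMap.coe_coe] at h1 h2
      rw [h1, h2]
    · intro f
      rw [LinearMap.add_apply, LinearMap.add_apply, DeltaEtaSlot_apply, DeltaEtaSlot_apply, TJSlotP_apply, TJSlotP_apply, hΔσ f, hTσ f, map_add, star_add, map_add]

end Summit.QuantumFields.YangMills.Theorems.Prop7Rows84AtEtaSlot

end
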